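import Mathlib
import Summits.QuantumFields.QCD.Theses.SpectralDefectExtinction

/-!
# Sketch — crux `WindowExtinction` (stmt-QuantumFields-18063), crux-ideate round 1, ideator 2

First-lemma sketches for two crux idea cards (planner `planner-cruxidea-stmt-QuantumFields-18063-2-0`):

* §A `uv-instanton-floor` — TIGHT⁺ sourced in the ultraviolet: the push lemma (proved) and the single-block
  semiclassical odds floor `BlockOddsFloor` / `UVInstantonFloor` (statements).
* §B `corner-decorrelation-deep-hole` — deep extinction from the annealed second moment of the Wilson hopping
  operator `K_U = 4 − D_W(U,0,1)`: Schur's majorant `#{roots z, |4 − z| ≥ R} ≤ ‖K_Uⁿ‖_F² / R^{2n}` (statement),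
  the two-line decay hypothesis `TwoLineDecay` and the deep-band extinction target `DeepBandExtinct` (statements).

Nothing here is a route item; `sorry` marks statements to be proved by a line, not claims.
-/

noncomputable section

namespace Summit.QuantumFields.QCD.Cruxes.WindowExtinction.IdeasR1K2

open scoped BigOperators Topology Classical ENNReal Matrix
open Filter MeasureTheory Matrix
open Literature.MathematicalPhysics.QuantumLattice Literature.MathematicalPhysics.QuantumFieldTheory
  Literature.Probability.LatticeModels
open Summit.QuantumFields.QCD.Theses.SpectralDefectExtinction

/-- The colour group. -/
local notation "SU3" => Matrix.specialUnitaryGroup (Fin 3) ℂ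

/-! ## §A  `uv-instanton-floor` -/

/-- **Push lemma** (one insertion, one level).  If `T` raises the integer observable `Q` by exactly one on a set
`G`, and the image of `μ|_G` under `T` is at least `ε` times as heavy as its preimage (`ε • T_*(μ|_G) ≤ μ`), then
for every level `m`: `ε · μ(G ∩ {Q ≥ m}) ≤ μ{Q ≥ m+1}`.  This is the atom of every anti-concentration argument of
the card (Hoeffding projections / Kolmogorov–Rogozin over conditionally independent blocks). -/
theorem push_level {Ω : Type*} [MeasurableSpace Ω] (μ : Measure Ω) (Q : Ω → ℤ) (T : Ω → Ω) (G : Set Ω)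
    (ε : ℝ≥0∞) (hQ : Measurable Q) (hT : Measurable T)
    (hQT : ∀ ω ∈ G, Q (T ω) = Q ω + 1) (hpush : ε • Measure.map T (μ.restrict G) ≤ μ) (m : ℤ) :
    ε * μ (G ∩ {ω | m ≤ Q ω}) ≤ μ {ω | m + 1 ≤ Q ω} := by
  have hS : MeasurableSet {ω | m + 1 ≤ Q ω} := hQ (measurableSet_Ici : MeasurableSet (Set.Ici (m + 1)))
  have h1 := hpush {ω | m + 1 ≤ Q ω}
  rw [Measure.smul_apply, Measure.map_apply hT hS, Measure.restrict_apply (hT hS), smul_eq_mul] at h1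
  refine le_trans (mul_le_mul_left' (measure_mono ?_) ε) h1  -- (deprecated alias; kept for robustness)
  intro ω hω
  have hωG : ω ∈ G := hω.1
  have hωm : m ≤ Q ω := hω.2
  refine ⟨?_, hωG⟩
  show m + 1 ≤ Q (T ω)
  rw [hQT ω hωG]
  linarith

/-- The phase-quenched density `∏_f |det D_W(U, m_f, 1)|` as an `ℝ≥0∞`-valued weight. -/
def pqDensity (Nf L : ℕ) [NeZero L] (mq : Fin Nf → ℝ) (U : GaugeConfig 4 L SU3) : ℝ≥0∞ :=
  ENNReal.ofReal (∏ f : Fin Nf, ‖fermionDet (wilsonDirac (fundamentalRep (Fin 3)) U (mq f) 1)‖)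

/-- The (unnormalised) phase-quenched measure `e^{−βS} ∏_f |det D_W(m_f)| dU` on the torus of side `L`. -/
def pqMeasure (Nf L : ℕ) [NeZero L] (β : ℝ) (mq : Fin Nf → ℝ) : Measure (GaugeConfig 4 L SU3) :=
  (wilsonMeasure (d := 4) (L := L) (fundamentalRep (Fin 3)) β).withDensity (pqDensity Nf L mq)

/-- The Wilson spectral index `n₋(Γ₅ D_W(U,m₀,1)) − 6 L⁴` (the TIGHT⁺ integrand without the absolute value). -/
def wilsonIndex (L : ℕ) [NeZero L] (U : GaugeConfig 4 L SU3) (m₀ : ℝ) : ℤ :=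
  ((Multiset.countP (fun z : ℂ => z.re < 0)
      (spinorLift gammaFive * wilsonDirac (fundamentalRep (Fin 3)) U m₀ 1).charpoly.roots : ℕ) : ℤ) -
    6 * (L : ℤ) ^ 4

/-- **Single-block semiclassical odds floor at step `k`** (the NEW input of the card, stated for ONE block of
radius `R k` based at the origin; translation covariance of the phase-quenched measure moves it to any block).
There is a measurable insertion map `T`, modifying only links based in the box `{−R_k..R_k}⁴`, and a good set `G` of
phase-quenched mass `≥ 3/4`, such that (i) the image of `μ₊|_G` under `T` is at least `e^{−K}` times as heavy as its
preimage and (ii) on `G` the Wilson index at the probe mass `m_crit(k) − a_k M/Z_k` goes up by exactly one. -/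
def BlockOddsFloor (Nf : ℕ) (reg : QCDRegularisation Nf) (m : Fin Nf → ℝ) (M K : ℝ) (R : ℕ → ℕ) (k : ℕ) : Prop :=
  ∃ (T : GaugeConfig 4 (2 * reg.L k + 1) SU3 → GaugeConfig 4 (2 * reg.L k + 1) SU3)
    (G : Set (GaugeConfig 4 (2 * reg.L k + 1) SU3)),
    Measurable T ∧ MeasurableSet G ∧
    (∀ (U : GaugeConfig 4 (2 * reg.L k + 1) SU3) (x : TorusSite 4 (2 * reg.L k + 1)) (μ : Fin 4),
      (∀ y ∈ box 4 (R k), Torus.proj (2 * reg.L k + 1) y ≠ x) → T U (x, μ) = U (x, μ)) ∧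
    4 * pqMeasure Nf (2 * reg.L k + 1) (reg.β k) (fun f => reg.mcrit k + reg.a k * m f / reg.Zm k) Gᶜ ≤
      pqMeasure Nf (2 * reg.L k + 1) (reg.β k) (fun f => reg.mcrit k + reg.a k * m f / reg.Zm k) Set.univ ∧
    ENNReal.ofReal (Real.exp (-K)) •
        Measure.map T ((pqMeasure Nf (2 * reg.L k + 1) (reg.β k)
          (fun f => reg.mcrit k + reg.a k * m f / reg.Zm k)).restrict G) ≤
      pqMeasure Nf (2 * reg.L k + 1) (reg.β k) (fun f => reg.mcrit k + reg.a k * m f / reg.Zm k) ∧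
    ∀ U ∈ G, wilsonIndex (2 * reg.L k + 1) (T U) (reg.mcrit k - reg.a k * M / reg.Zm k) =
      wilsonIndex (2 * reg.L k + 1) U (reg.mcrit k - reg.a k * M / reg.Zm k) + 1

/-- **UV instanton floor** (card A's transfer target, the conjunction handed to the landed anti-concentration
machinery): for some entropy constant `K`, a physical instanton size `ρ₀ > 0` and block radii `R_k` with
`a_k R_k → ρ₀` (blocks of FIXED physical size, huge in lattice units), the single-block odds floor holds at every
mass tuple above `M₀` and every probe depth `M > M₀`, eventually in `k`. With `N_k ≍ (a_k(2L_k+1)/ρ₀)⁴` disjoint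
translates this yields `E₊|index| ≥ c e^{−K/2} N_k^{1/2} = η (a_k(2L_k+1))²`, i.e. TIGHT⁺. -/
def UVInstantonFloor (Nf : ℕ) (reg : QCDRegularisation Nf) (M₀ : ℝ) : Prop :=
  ∃ (K ρ₀ : ℝ) (R : ℕ → ℕ), 0 < ρ₀ ∧ Tendsto (fun k => reg.a k * R k) atTop (𝓝 ρ₀) ∧
    ∀ m : Fin Nf → ℝ, (∀ f, M₀ < m f) → ∀ M : ℝ, M₀ < M → ∀ᶠ k : ℕ in atTop, BlockOddsFloor Nf reg m M K R k

/-! ## §B  `corner-decorrelation-deep-hole` -/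

/-- The Wilson hopping operator `K_U := 4 − D_W(U,0,1)` (so that real eigenvalues `λ` of `D_W(U,0,1)` below `t`
are real eigenvalues `k = 4 − λ > 4 − t` of `K_U`, and `‖K_U‖ ≤ 4`). -/
def hopK {L : ℕ} [NeZero L] (U : GaugeConfig 4 L SU3) :
    Matrix (TorusSite 4 L × Fin 3 × Fin 4) (TorusSite 4 L × Fin 3 × Fin 4) ℂ :=
  (4 : ℂ) • (1 : Matrix _ _ ℂ) - wilsonDirac (fundamentalRep (Fin 3)) U 0 1

/-- Squared Frobenius norm `‖A‖_F² = Σ_{i,j} |A_{ij}|²`, written as an explicit sum. -/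
def frobSq {ι : Type*} [Fintype ι] (A : Matrix ι ι ℂ) : ℝ := ∑ i, ∑ j, ‖A i j‖ ^ 2

/-- **First lemma of card B (Schur majorant + Chebyshev), every gauge field.**  For `R > 0` and `n ≥ 1` the
number of characteristic roots `z` of `D_W(U,0,1)` (real OR complex, with multiplicity) with `|4 − z| ≥ R` is at
most `‖K_Uⁿ‖_F² / R^{2n}`: Schur's inequality `Σ_i |λ_i(A)|² ≤ ‖A‖_F²` applied to `A = K_Uⁿ`, whose eigenvalues are
`(4 − z_i)ⁿ`.  In particular the EXTINCT(a) integrand at threshold `t` is bounded by `‖K_Uⁿ‖_F²/(4 − t)^{2n}`. -/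
theorem rootsOutsideDisc_le_frobSq_pow {L : ℕ} [NeZero L] (U : GaugeConfig 4 L SU3) {R : ℝ} (hR : 0 < R)
    {n : ℕ} (hn : 1 ≤ n) :
    (Multiset.countP (fun z : ℂ => R ≤ ‖(4 : ℂ) - z‖)
        (wilsonDirac (fundamentalRep (Fin 3)) U 0 1).charpoly.roots : ℝ) ≤
      frobSq (hopK U ^ n) / R ^ (2 * n) := by
  sorry

/-- Corollary shape used by EXTINCT(a): real roots below `t < 4` have `|4 − z| = 4 − Re z > 4 − t`. -/
theorem signDefects_le_frobSq_pow {L : ℕ} [NeZero L] (U : GaugeConfig 4 L SU3) {t : ℝ} (ht : t < 4)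
    {n : ℕ} (hn : 1 ≤ n) :
    (Multiset.countP (fun z : ℂ => z.im = 0 ∧ z.re < t)
        (wilsonDirac (fundamentalRep (Fin 3)) U 0 1).charpoly.roots : ℝ) ≤
      frobSq (hopK U ^ n) / (4 - t) ^ (2 * n) := by
  have hR : 0 < 4 - t := by linarith
  refine le_trans ?_ (rootsOutsideDisc_le_frobSq_pow U hR hn)
  have hmono : ((wilsonDirac (fundamentalRep (Fin 3)) U 0 1).charpoly.roots.countP
        (fun z : ℂ => z.im = 0 ∧ z.re < t)) ≤
      ((wilsonDirac (fundamentalRep (Fin 3)) U 0 1).charpoly.roots.countP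
        (fun z : ℂ => 4 - t ≤ ‖(4 : ℂ) - z‖)) := by
    rw [Multiset.countP_eq_card_filter, Multiset.countP_eq_card_filter]
    refine Multiset.card_le_card (Multiset.monotone_filter_right _ ?_)
    intro z hz
    have him : ((4 : ℂ) - z).im = 0 := by simp [hz.1]
    have hre : ((4 : ℂ) - z).re = 4 - z.re := by simp
    have hreal : ‖(4 : ℂ) - z‖ = |4 - z.re| := by
      rw [← hre]
      have : (4 : ℂ) - z = (((4 : ℂ) - z).re : ℂ) := Complex.ext (by simp) (by simp [him])
      rw [this, Complex.norm_real, Real.norm_eq_abs, Complex.ofReal_re]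
    rw [hreal]
    have : 4 - t ≤ 4 - z.re := by linarith [hz.2]
    exact this.trans (le_abs_self _)
  exact_mod_cast hmono

/-- **Two-line decay** (card B's hardest stub, pure-gauge form): the annealed second moment of `K_Uⁿ` — by Fubini a
spin-dressed sum over Wilson loops made of two quark lines of length `n` — grows at a rate strictly below the free
rate `4`, by `c₁/β`, uniformly in the volume, for path lengths up to `β³` (far below the Lifshitz scale). -/
def TwoLineDecay : Prop :=
  ∃ c₁ C : ℝ, 0 < c₁ ∧ 0 < C ∧ ∀ β : ℝ, 1 ≤ β → ∀ (L : ℕ) [NeZero L], ∀ n : ℕ, 1 ≤ n → (n : ℝ) ≤ β ^ 3 →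
    ∫ U, frobSq (hopK U ^ n) ∂(wilsonMeasure (d := 4) (L := L) (fundamentalRep (Fin 3)) β) ≤
      C * (L : ℝ) ^ 4 * (4 - c₁ / β) ^ (2 * n)

/-- Phase-quenched two-line decay along a regularisation (the form EXTINCT consumes): the same bound for the
`∏_f|det|`-weighted mean at `(β_k, m_f(k))`, on every torus at least the scheme's. -/
def TwoLineDecayPQ (Nf : ℕ) (reg : QCDRegularisation Nf) (M₀ c₁ : ℝ) : Prop :=
  ∃ C : ℝ, 0 < C ∧ ∀ m : Fin Nf → ℝ, (∀ f, M₀ < m f) → ∀ᶠ k : ℕ in atTop, ∀ S : ℕ, reg.L k ≤ S →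
    ∀ n : ℕ, 1 ≤ n → (n : ℝ) ≤ reg.β k ^ 3 →
      (∫ U, frobSq (hopK U ^ n) *
          ∏ f : Fin Nf, ‖fermionDet (wilsonDirac (fundamentalRep (Fin 3)) U (reg.mcrit k + reg.a k * m f / reg.Zm k) 1)‖
          ∂(wilsonMeasure (d := 4) (L := 2 * S + 1) (fundamentalRep (Fin 3)) (reg.β k))) /
        (∫ U, ∏ f : Fin Nf, ‖fermionDet (wilsonDirac (fundamentalRep (Fin 3)) U (reg.mcrit k + reg.a k * m f / reg.Zm k) 1)‖
          ∂(wilsonMeasure (d := 4) (L := 2 * S + 1) (fundamentalRep (Fin 3)) (reg.β k))) ≤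
      C * ((2 * S + 1 : ℝ)) ^ 4 * (4 - c₁ / reg.β k) ^ (2 * n)

/-- **Deep-band extinction** (what card B delivers towards EXTINCT): the phase-quenched expected number of
characteristic roots `z` of `D_W(U,0,1)` — real or complex — with `|4 − z| ≥ 4 − c₁/(2β_k)` (the bottom of the
Wilson hole, up to depth `c₁/(2β_k) = c₁ g₀²/4` from the tip side) is `≤ ε ((2S+1)/(2L_k+1))⁴` on every torus at
least the scheme's, eventually in `k`, under the polynomial volume cap. -/
def DeepBandExtinct (Nf : ℕ) (reg : QCDRegularisation Nf) (M₀ c₁ : ℝ) : Prop :=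
  ∀ m : Fin Nf → ℝ, (∀ f, M₀ < m f) → ∀ ε : ℝ, 0 < ε → ∀ᶠ k : ℕ in atTop, ∀ S : ℕ, reg.L k ≤ S →
    (∫ U, (Multiset.countP (fun z : ℂ => 4 - c₁ / (2 * reg.β k) ≤ ‖(4 : ℂ) - z‖)
          (wilsonDirac (fundamentalRep (Fin 3)) U 0 1).charpoly.roots : ℝ) *
        ∏ f : Fin Nf, ‖fermionDet (wilsonDirac (fundamentalRep (Fin 3)) U (reg.mcrit k + reg.a k * m f / reg.Zm k) 1)‖
        ∂(wilsonMeasure (d := 4) (L := 2 * S + 1) (fundamentalRep (Fin 3)) (reg.β k))) /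
      (∫ U, ∏ f : Fin Nf, ‖fermionDet (wilsonDirac (fundamentalRep (Fin 3)) U (reg.mcrit k + reg.a k * m f / reg.Zm k) 1)‖
        ∂(wilsonMeasure (d := 4) (L := 2 * S + 1) (fundamentalRep (Fin 3)) (reg.β k))) ≤
      ε * ((2 * S + 1 : ℝ) / (2 * reg.L k + 1)) ^ 4

/-- **Deep extinction from two-line decay** (the composition card B proposes; Chebyshev at path length
`n_k ≍ C' β_k log(1/a_k) ≤ β_k³` plus the polynomial volume cap and asymptotic scaling `β_k ≍ 4b₀ log(1/a_k)`). -/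
theorem deepBandExtinct_of_twoLineDecayPQ (Nf : ℕ) (reg : QCDRegularisation Nf) (M₀ c₁ : ℝ) (hc₁ : 0 < c₁)
    (hAS : (reg.scheme 0 0 0).HasAsymptoticScaling)
    (hcap : ∃ p : ℕ, ∀ᶠ k : ℕ in atTop, (reg.L k : ℝ) ≤ (reg.a k)⁻¹ ^ p) :
    TwoLineDecayPQ Nf reg M₀ c₁ → DeepBandExtinct Nf reg M₀ c₁ := by
  sorry

end Summit.QuantumFields.QCD.Cruxes.WindowExtinction.IdeasR1K2
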